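import Summits.Ventures.HodgeRepro.Night3GSetWeilModel
import Summits.Ventures.HodgeRepro.Night3FaceClosureTwist

/-!
# The Galois twist on the `G`-set model: `twistMul M g` relabels the coordinates, the concrete Weil space is carried to
the concrete Weil space, and twist invariance of «algebraic» (`htwist`) follows from twist compatibility of `Alg`

Blind re-derivation cell `pub-hodge-repro`, seat `night-3` (gen 4).  Imports night-3's `Night3GSetWeilModel` (the
concrete model `H M = ⋀^{|M|} ℂ^{Fin |M| × G}`, the lines, `weilSpace`, `castH`) and `Night3FaceClosureTwist` (gen 3's
Galois twist `twistMul M g = {T·g : T ∈ M}` and the twist reduction «S4 on one face per twist class ⟹ S4», whose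
hypothesis `htwist : ∀ M g, Alg M → Alg (twistMul M g)` this file discharges on the concrete model from a
hypothesis about `Alg` alone).  Namespace `HodgeRepro.Night3.GSetModel`.

THE PRINTED REASON (NIGHT3.md §9.1): `A_{T·g}` is the complex torus `A_T` with `F` acting through `g`
(`Φ_{T·g}(x) = Φ_T(g x)`), so `H^•(B_{M·g}, ℂ) = H^•(B_M, ℂ)` with the `σ`-eigenline of `B_{M·g}` equal to the
`σg⁻¹`-eigenline of `B_M`: in eigen-coordinates the identification is the RELABELLING `(i, τ) ↦ (i, τ g)` of
`Fin |M| × G`, and the algebraic classes — classes of the same variety — correspond under it.  On the kernel: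

* `relabelH n e : Hn G n ≃ₗ[ℂ] Hn G n` — the coordinate relabelling `(i, τ) ↦ (i, e τ)` on `⋀^n ℂ^{Fin n × G}`
  (`exteriorPower.map` of `LinearEquiv.funCongrLeft`); `relabelH_line : relabelH n e (line n τ) = line n (e τ)`;
* `twistEquiv M g : H M ≃ₗ[ℂ] H (twistMul M g)` — the relabelling by `τ ↦ τ g` followed by the cast
  `|M| = |M·g|`; **`map_twistEquiv_weilSpace`**: the concrete Weil space of `M` is carried onto that of `M·g`
  (the lines are permuted);
* **`htwist_of_alg`**: if `Alg` is twist-compatible — `(Alg M).map (twistEquiv M g) ≤ Alg (twistMul M g)` — then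
  `weilSpace M ≤ Alg M → weilSpace (twistMul M g) ≤ Alg (twistMul M g)`: the field `htwist` of gen 3's twist
  reduction is a THEOREM of the concrete model, modulo the one identification of `Alg` along the twist.

Nothing geometric is built; nothing here says anything about the status of the Hodge conjecture for CM abelian
varieties, which is NOT proved.
-/

set_option autoImplicit false

open Finset Module TensorProduct
open scoped Pointwise

namespace HodgeRepro.Night3.GSetModel

open HodgeRepro.CMHodgeOn HodgeRepro.Night3.GSet

section Relabel

variable {G : Type*} [DecidableEq G]

/-- The relabelling `(i, τ) ↦ (i, e τ)` of the eigen-coordinates, on `ℂ^{Fin n × G}` (as `f ↦ f ∘ (id × e)⁻¹`, so that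
the coordinate vector `e_{(i,τ)}` goes to `e_{(i, e τ)}`). -/
noncomputable def relabelV (n : ℕ) (e : G ≃ G) : V G n ≃ₗ[ℂ] V G n :=
  LinearEquiv.funCongrLeft ℂ ℂ ((Equiv.refl (Fin n)).prodCongr e).symm

/-- `relabelV` carries `e_{(i,τ)}` to `e_{(i, e τ)}`. -/
theorem relabelV_coordVecOn (n : ℕ) (e : G ≃ G) (x : Fin n × G) :
    relabelV n e (coordVecOn x) = coordVecOn (x.1, e x.2) := by
  funext z
  rcases z with ⟨i, τ⟩
  have h1 : relabelV n e (coordVecOn x) (i, τ) = coordVecOn x (i, e.symm τ) := rfl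
  rw [h1, coordVecOn_apply, coordVecOn_apply]
  simp only [Prod.ext_iff, Equiv.symm_apply_eq]

/-- The relabelling on `⋀^n ℂ^{Fin n × G}`. -/
noncomputable def relabelH (n : ℕ) (e : G ≃ G) : Hn G n ≃ₗ[ℂ] Hn G n :=
  LinearEquiv.ofLinear (exteriorPower.map n (relabelV n e).toLinearMap)
    (exteriorPower.map n (relabelV n e).symm.toLinearMap)
    (by rw [← exteriorPower.map_comp, LinearEquiv.comp_symm, exteriorPower.map_id])
    (by rw [← exteriorPower.map_comp, LinearEquiv.symm_comp, exteriorPower.map_id])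

omit [DecidableEq G] in
/-- `relabelH n e` is `exteriorPower.map` of the relabelling. -/
theorem relabelH_apply (n : ℕ) (e : G ≃ G) (x : Hn G n) :
    relabelH n e x = exteriorPower.map n (relabelV n e).toLinearMap x := rfl

/-- **The relabelling permutes the lines**: `relabelH n e (line n τ) = line n (e τ)`. -/
theorem relabelH_line (n : ℕ) (e : G ≃ G) (τ : G) : relabelH n e (line n τ) = line n (e τ) := by
  rw [relabelH_apply, line, line, coordWedgeOn, coordWedgeOn, exteriorPower.map_apply_ιMulti]
  congr 1
  funext i
  rw [Function.comp_apply, LinearEquiv.coe_coe, relabelV_coordVecOn]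

/-- **The relabelling preserves the span of the lines.** -/
theorem map_relabelH_span_line (n : ℕ) (e : G ≃ G) :
    (Submodule.span ℂ (Set.range (line n))).map (relabelH n e : Hn G n →ₗ[ℂ] Hn G n) =
      Submodule.span ℂ (Set.range (line (G := G) n)) := by
  rw [Submodule.map_span, ← Set.range_comp]
  congr 1
  have : (relabelH n e : Hn G n →ₗ[ℂ] Hn G n) ∘ line n = line n ∘ e := by
    funext τ
    exact relabelH_line n e τ
  rw [this, Set.range_comp, e.surjective.range_eq, Set.image_univ]

end Relabel

section Twist

variable {G : Type*} [Group G] [Fintype G] [DecidableEq G] [LinearOrder G]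

omit [Fintype G] [DecidableEq G] [LinearOrder G] in
/-- The twist has the same number of factors. -/
theorem card_twistMul (M : Multiset (Finset G)) (g : G) : Multiset.card (twistMul M g) = Multiset.card M :=
  Multiset.card_map _ _

omit [Fintype G] [LinearOrder G] in
/-- **The twist identification** `H^•(B_M) ≃ H^•(B_{M·g})`: relabel `(i, τ) ↦ (i, τ g)` (the `σ`-eigenline of
`B_{M·g}` is the `σg⁻¹`-eigenline of `B_M`), then the cast `|M| = |M·g|`. -/
noncomputable def twistEquiv (M : Multiset (Finset G)) (g : G) : H M ≃ₗ[ℂ] H (twistMul M g) :=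
  (relabelH (Multiset.card M) (Equiv.mulRight g)).trans (castH (card_twistMul M g).symm)

omit [Fintype G] [LinearOrder G] in
/-- **The concrete Weil space is carried to the concrete Weil space by the twist identification.** -/
theorem map_twistEquiv_weilSpace (M : Multiset (Finset G)) (g : G) :
    (weilSpace M).map (twistEquiv M g : H M →ₗ[ℂ] H (twistMul M g)) = weilSpace (twistMul M g) := by
  rw [twistEquiv, LinearEquiv.coe_trans, Submodule.map_comp, weilSpace, map_relabelH_span_line,
    Submodule.map_span, ← Set.range_comp, weilSpace]
  congr 2
  funext τ
  exact castH_line _ τ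

omit [Fintype G] [LinearOrder G] in
/-- **`htwist` as a theorem of the concrete model**: if the algebraic classes are twist-compatible
(`(Alg M).map (twistEquiv M g) ≤ Alg (twistMul M g)` — the classes of the same variety `B_{M·g} = B_M`), then
«`W_F(B_M)` algebraic ⟹ `W_F(B_{M·g})` algebraic». -/
theorem htwist_of_alg (Alg : ∀ M : Multiset (Finset G), Submodule ℂ (H M))
    (halg : ∀ M g, (Alg M).map (twistEquiv M g : H M →ₗ[ℂ] H (twistMul M g)) ≤ Alg (twistMul M g))
    (M : Multiset (Finset G)) (g : G) (hM : weilSpace M ≤ Alg M) :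
    weilSpace (twistMul M g) ≤ Alg (twistMul M g) := by
  rw [← map_twistEquiv_weilSpace]
  exact (Submodule.map_mono hM).trans (halg M g)

end Twist

end HodgeRepro.Night3.GSetModel
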